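import Summits.Ventures.CertifiedQuantumChemistry.Rows.SectorRows
import HarnessLib

/-!
# Ventures/CertifiedQuantumChemistry — Rows/LowerCertificateCompleteness.lean: the LOWER predicate is complete

HONEST FRAMING (verbatim): certified bounds for a stated model Hamiltonian in a stated basis; not a
claim about the real molecule beyond that model.

Typer file (seat `pub-qchem-typer`, T-04 complement; theorems only, no `def`, no claim node, no model,
NO BOUND ASSERTED). `Rows/SectorRows.lean` proves SOUNDNESS of both certificate predicates and
COMPLETENESS of the upper one (`upperCertificate_iff_upperRow`: every true upper row has a Rayleigh
witness, the sector ground state). This file proves the missing converse on the LOWER side: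

* `lowerCertificate_of_lowerRow` — for a symmetric model, EVERY true lower row
  `LowerRow F a b lo` has a certificate of the exact shape `LowerCertificate F a b lo` of
  `Rows/SectorRows.lean` (PSD Gram part + two-sided multipliers of the spin-resolved sector ideals
  `N̂_↑ − a`, `N̂_↓ − b`; no commutator rows, no charged words, no rounding residual, `c = lo`);
* `lowerCertificate_iff_lowerRow` — hence `LowerCertificate F a b lo ↔ LowerRow F a b lo` on the
  physical range, exactly as on the upper side.

CONSEQUENCE FOR THE CELL. A claim node `cert_… : LowerCertificate <model> a b lo` of a
`Certificates/*.lean` file asserts NOTHING MORE than the row it carries: the predicate the readers of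
record verify from the files is, as a proposition, equivalent to `lo ≤ E₀(H_F; a, b)` (with the range).
This is completeness of the PREDICATE (existence of some exact SOS certificate in the cell's format),
not tightness of any relaxation rung: the witness built here uses the full sector block of `H_F − lo`
as its Gram part (an "exact-diagonalisation" certificate), and says nothing about what D / DQG / DQGT1 /
T2′-sized operator families can certify.

PROOF (finite-dimensional linear algebra, ≈ Garrod–Percus / v2RDM duality at full rank). Let
`A = H_F − lo·1`, `P` the (diagonal) projector onto the `(a, b)` occupation sector, `P_↑` the projector
onto `N̂_↑ = a`, and `Z_↑`, `Z_↓` the diagonal pseudo-inverses of `N̂_↑ − a`, `N̂_↓ − b`. Then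
`1 − P = Z_↑ (N̂_↑ − a) + P_↑ Z_↓ (N̂_↓ − b)` (all diagonal, pairwise commuting), so
`A = P A P + A (1 − P) + (1 − P) A P
   = P A P + (A Z_↑)(N̂_↑ − a) + (N̂_↑ − a)(Z_↑ A P) + (A P_↑ Z_↓)(N̂_↓ − b) + (N̂_↓ − b)(P_↑ Z_↓ A P)`,
which is the certificate shape with one `Z`-pair and one `S`-pair; and `P A P ⪰ 0` because for every
`x`, `⟨x, P A P x⟩ = ⟨Px, (H_F − lo) Px⟩ ≥ (E₀ − lo)‖Px‖² ≥ 0` by the sector variational principle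
(`sectorGroundEnergy_mul_le_re_rayleigh`) and the row's `lo ≤ E₀`. Finally every square matrix `M`
on the Fock index set is a `gramForm` after reindexing to `Fin n`:
`M = Σ_{st} M_{st} • (|s₀⟩⟨s|)ᴴ (|s₀⟩⟨t|)` (`gramForm_submatrix_single`).
-/

noncomputable section

namespace Summit.Ventures.CertifiedQuantumChemistry

open Matrix Finset
open Literature.MathematicalPhysics.QuantumLattice Literature.MathematicalPhysics.QuantumChemistry
open Literature.MathematicalPhysics.QuantumManyBody.StateRelaxation
open scoped ComplexOrder

variable {k : ℕ}

/-! ## Three generic matrix facts -/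

/-- Every square complex matrix on a finite index type is a Gram element of the cell's format after
reindexing to `Fin n`: with `O i = |s₀⟩⟨e⁻¹ i|` one has `(O i)ᴴ (O j) = |e⁻¹ i⟩⟨e⁻¹ j|`, so
`gramForm (M ∘ e⁻¹) O = Σ_{st} M_{st} |s⟩⟨t| = M`. -/
theorem gramForm_submatrix_single {ι : Type*} [Fintype ι] [DecidableEq ι] (M : Matrix ι ι ℂ)
    (s₀ : ι) {n : ℕ} (e : ι ≃ Fin n) :
    gramForm (M.submatrix e.symm e.symm) (fun i => Matrix.single s₀ (e.symm i) (1 : ℂ)) = M := by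
  unfold gramForm
  have h : ∀ i j : Fin n, (M.submatrix e.symm e.symm i j) •
      (star (Matrix.single s₀ (e.symm i) (1 : ℂ)) * Matrix.single s₀ (e.symm j) (1 : ℂ)) =
      Matrix.single (e.symm i) (e.symm j) (M (e.symm i) (e.symm j)) := by
    intro i j
    rw [submatrix_apply, Matrix.star_eq_conjTranspose, conjTranspose_single, star_one,
      single_mul_single_same, one_mul, smul_single, smul_eq_mul, mul_one]
  simp_rw [h]
  calc ∑ i : Fin n, ∑ j : Fin n, Matrix.single (e.symm i) (e.symm j) (M (e.symm i) (e.symm j))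
      = ∑ i : Fin n, ∑ t : ι, Matrix.single (e.symm i) t (M (e.symm i) t) := by
        refine Finset.sum_congr rfl fun i _ => ?_
        exact e.symm.sum_comp (fun t => Matrix.single (e.symm i) t (M (e.symm i) t))
    _ = ∑ s : ι, ∑ t : ι, Matrix.single s t (M s t) :=
        e.symm.sum_comp (fun s => ∑ t : ι, Matrix.single s t (M s t))
    _ = M := (matrix_eq_sum_single M).symm

/-- The quadratic form of a Hermitian matrix is real. -/
theorem im_star_dotProduct_mulVec_self {ι : Type*} [Fintype ι] {A : Matrix ι ι ℂ}
    (hA : A.IsHermitian) (x : ι → ℂ) : (star x ⬝ᵥ A *ᵥ x).im = 0 := by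
  have h : star (star x ⬝ᵥ A *ᵥ x) = star x ⬝ᵥ A *ᵥ x := by
    rw [← star_dotProduct, star_mulVec, hA.eq, ← dotProduct_mulVec]
  exact Complex.conj_eq_iff_im.mp h

/-- For a Hermitian diagonal-real projector-like matrix `P = diagonal p` with `star p = p`, the
quadratic form of `P A P` at `x` is that of `A` at `P x`. -/
theorem star_dotProduct_diagonal_mul_mul_diagonal_mulVec {ι : Type*} [Fintype ι] [DecidableEq ι]
    (p : ι → ℂ) (hp : ∀ s, star (p s) = p s) (A : Matrix ι ι ℂ) (x : ι → ℂ) :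
    star x ⬝ᵥ (diagonal p * A * diagonal p) *ᵥ x =
      star (diagonal p *ᵥ x) ⬝ᵥ A *ᵥ (diagonal p *ᵥ x) := by
  have hP : (diagonal p)ᴴ = diagonal p := by
    rw [diagonal_conjTranspose]
    exact congrArg diagonal (funext hp)
  rw [← mulVec_mulVec, ← mulVec_mulVec, dotProduct_mulVec, star_mulVec, hP]

/-! ## The spin-resolved number operators are diagonal in the occupation basis -/

/-- `N̂_σ = Σ_y n_{yσ}` is the diagonal matrix of the `σ`-occupation count. -/
theorem sum_numberOp_eq_diagonal (σ : Fin 2) :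
    (∑ y : Fin k, numberOp y σ : Op k) =
      diagonal fun s => ((univ.filter fun x : Fin k => orb x σ ∈ s).card : ℂ) := by
  ext s t
  rw [Matrix.sum_apply, diagonal_apply]
  simp only [LiebThm1.numberOp_eq_diagonal, diagonal_apply]
  split_ifs with h
  · rw [Finset.sum_boole]
  · exact Finset.sum_const_zero

/-- `N̂_↑ − a·1` is the diagonal matrix `diag(N_↑(s) − a)`. -/
theorem sum_numberOp_up_sub_eq_diagonal (a : ℕ) :
    (∑ y : Fin k, numberOp y 0 - (a : ℂ) • (1 : Op k) : Op k) =
      diagonal fun s => ((upPart s).card : ℂ) - a := by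
  rw [sum_numberOp_eq_diagonal, smul_one_eq_diagonal, diagonal_sub]
  rfl

/-- `N̂_↓ − b·1` is the diagonal matrix `diag(N_↓(s) − b)`. -/
theorem sum_numberOp_down_sub_eq_diagonal (b : ℕ) :
    (∑ y : Fin k, numberOp y 1 - (b : ℂ) • (1 : Op k) : Op k) =
      diagonal fun s => ((downPart s).card : ℂ) - b := by
  rw [sum_numberOp_eq_diagonal, smul_one_eq_diagonal, diagonal_sub]
  rfl

/-! ## The sector projector and the pseudo-inverses of the number ideals (as diagonal matrices) -/

/-- KEY POINTWISE IDENTITY behind `1 − P = Z_↑ (N̂_↑ − a) + P_↑ Z_↓ (N̂_↓ − b)`: with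
`z_↑ = (N_↑ − a)⁻¹` off `N_↑ = a` (else `0`) and `w = [N_↑ = a] · (N_↓ − b)⁻¹` off `N_↓ = b` (else `0`),
`z_↑ (N_↑ − a) + w (N_↓ − b) = 1 − [N_↑ = a ∧ N_↓ = b]`. -/
theorem pinv_identity (a b nu nd : ℕ) :
    (if nu = a then (0 : ℂ) else ((nu : ℂ) - a)⁻¹) * ((nu : ℂ) - a) +
      ((if nu = a then (1 : ℂ) else 0) * (if nd = b then (0 : ℂ) else ((nd : ℂ) - b)⁻¹)) *
        ((nd : ℂ) - b) =
      1 - (if nu = a ∧ nd = b then (1 : ℂ) else 0) := by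
  by_cases hu : nu = a
  · subst hu
    by_cases hd : nd = b
    · subst hd
      simp
    · have hne : ((nd : ℂ) - b) ≠ 0 := by
        rw [sub_ne_zero]
        exact_mod_cast hd
      simp [hd, inv_mul_cancel₀ hne]
  · have hne : ((nu : ℂ) - a) ≠ 0 := by
      rw [sub_ne_zero]
      exact_mod_cast hu
    simp [hu, inv_mul_cancel₀ hne]

/-- **P A P is positive semidefinite when `lo ≤ E₀`.** For a symmetric model and a true lower row,
the sector compression of `H_F − lo·1` by the diagonal occupation-sector projector is PSD
(sector variational principle `sectorGroundEnergy_mul_le_re_rayleigh`). -/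
theorem posSemidef_sectorCompression {F : Model k} (hF : F.IsSymmetric) {a b : ℕ} {lo : ℚ}
    (h : LowerRow F a b lo) :
    (diagonal (fun s : Finset (Orb (Fin k)) =>
          if (upPart s).card = a ∧ (downPart s).card = b then (1 : ℂ) else 0) *
        (F.hamiltonian - ((((lo : ℚ) : ℝ) : ℝ) : ℂ) • (1 : Op k)) *
      diagonal (fun s : Finset (Orb (Fin k)) =>
          if (upPart s).card = a ∧ (downPart s).card = b then (1 : ℂ) else 0)).PosSemidef := by
  set p : Finset (Orb (Fin k)) → ℂ :=
    fun s => if (upPart s).card = a ∧ (downPart s).card = b then (1 : ℂ) else 0 with hpdef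
  set A : Op k := F.hamiltonian - ((((lo : ℚ) : ℝ) : ℝ) : ℂ) • (1 : Op k) with hAdef
  have hH : F.hamiltonian.IsHermitian := Model.hamiltonian_isHermitian hF
  have hp : ∀ s, star (p s) = p s := by
    intro s
    simp only [hpdef]
    split_ifs <;> simp
  have hP : (diagonal p)ᴴ = diagonal p := by
    rw [diagonal_conjTranspose]
    exact congrArg diagonal (funext hp)
  have hA : A.IsHermitian := by
    refine hH.sub ?_
    change (((((lo : ℚ) : ℝ) : ℝ) : ℂ) • (1 : Op k))ᴴ = _
    rw [conjTranspose_smul, conjTranspose_one, Complex.star_def, Complex.conj_ofReal]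
  have hPAP : (diagonal p * A * diagonal p).IsHermitian := by
    have := isHermitian_conjTranspose_mul_mul (diagonal p) hA
    rwa [hP] at this
  refine PosSemidef.of_dotProduct_mulVec_nonneg hPAP fun x => ?_
  rw [star_dotProduct_diagonal_mul_mul_diagonal_mulVec p hp A x]
  set ψ : Fock (Orb (Fin k)) := diagonal p *ᵥ x with hψdef
  -- `ψ = P x` lies in the `(a, b)` sector
  have hψ : IsInSector a b ψ := by
    intro s hs
    rw [hψdef, mulVec_diagonal, hpdef]
    simp only [hs, if_false, zero_mul]
  -- the quadratic form of `A` at `ψ`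
  have hq : star ψ ⬝ᵥ A *ᵥ ψ =
      star ψ ⬝ᵥ F.hamiltonian *ᵥ ψ - ((((lo : ℚ) : ℝ) : ℝ) : ℂ) * (star ψ ⬝ᵥ ψ) := by
    rw [hAdef, sub_mulVec, smul_mulVec, one_mulVec, dotProduct_sub, dotProduct_smul,
      smul_eq_mul]
  have hvar := sectorGroundEnergy_mul_le_re_rayleigh hH hψ
  have hlo : (((lo : ℚ) : ℝ) : ℝ) ≤ sectorGroundEnergy F.hamiltonian a b := h.le
  have hnorm : 0 ≤ (star ψ ⬝ᵥ ψ).re := (Complex.nonneg_iff.mp (dotProduct_star_self_nonneg ψ)).1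
  have hnorm_im : (star ψ ⬝ᵥ ψ).im = 0 :=
    ((Complex.nonneg_iff.mp (dotProduct_star_self_nonneg ψ)).2).symm
  rw [hq, Complex.nonneg_iff]
  constructor
  · rw [Complex.sub_re, Complex.re_ofReal_mul, sub_nonneg]
    exact (mul_le_mul_of_nonneg_right hlo hnorm).trans hvar
  · rw [Complex.sub_im, Complex.im_ofReal_mul, hnorm_im, mul_zero, sub_zero,
      im_star_dotProduct_mulVec_self hH ψ]

/-! ## Completeness -/

/-- **COMPLETENESS OF THE LOWER PREDICATE (T-04 L, converse).** Every true lower row of a symmetric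
model HAS a lower certificate of the cell's format: `LowerRow F a b lo → LowerCertificate F a b lo`.
Witness: Gram part = the sector compression `P (H_F − lo) P` (PSD by `posSemidef_sectorCompression`,
written as a `gramForm` over the matrix units by `gramForm_submatrix_single`), one two-sided multiplier
pair for each spin-resolved number ideal (`A Z_↑`, `Z_↑ A P`; `A P_↑ Z_↓`, `P_↑ Z_↓ A P`), all other
families empty, `c = lo`, no residual. -/
theorem lowerCertificate_of_lowerRow {F : Model k} (hF : F.IsSymmetric) {a b : ℕ} {lo : ℚ}
    (h : LowerRow F a b lo) : LowerCertificate F a b lo := by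
  classical
  -- the diagonal data
  set ι := Finset (Orb (Fin k)) with hιdef
  set p : ι → ℂ := fun s => if (upPart s).card = a ∧ (downPart s).card = b then (1 : ℂ) else 0
    with hpdef
  set u : ι → ℂ := fun s => ((upPart s).card : ℂ) - a with hudef
  set v : ι → ℂ := fun s => ((downPart s).card : ℂ) - b with hvdef
  set zu : ι → ℂ := fun s => if (upPart s).card = a then (0 : ℂ) else (((upPart s).card : ℂ) - a)⁻¹
    with hzudef
  set w : ι → ℂ := fun s => (if (upPart s).card = a then (1 : ℂ) else 0) *
      (if (downPart s).card = b then (0 : ℂ) else (((downPart s).card : ℂ) - b)⁻¹) with hwdef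
  set A : Op k := F.hamiltonian - ((((lo : ℚ) : ℝ) : ℝ) : ℂ) • (1 : Op k) with hAdef
  set P : Op k := diagonal p with hPdef
  set Du : Op k := diagonal u with hDudef
  set Dv : Op k := diagonal v with hDvdef
  set Zu : Op k := diagonal zu with hZudef
  set W : Op k := diagonal w with hWdef
  -- `1 − P = Zu Du + W Dv = Du Zu + Dv W`
  have hkey : ∀ s, zu s * u s + w s * v s = 1 - p s := fun s =>
    pinv_identity a b (upPart s).card (downPart s).card
  have h1 : Zu * Du + W * Dv = 1 - P := by
    rw [hZudef, hDudef, hWdef, hDvdef, hPdef, diagonal_mul_diagonal, diagonal_mul_diagonal,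
      diagonal_add, ← diagonal_one, diagonal_sub]
    exact congrArg diagonal (funext hkey)
  have h2 : Du * Zu + Dv * W = 1 - P := by
    rw [hZudef, hDudef, hWdef, hDvdef, hPdef, diagonal_mul_diagonal, diagonal_mul_diagonal,
      diagonal_add, ← diagonal_one, diagonal_sub]
    exact congrArg diagonal (funext fun s => by rw [mul_comm (u s), mul_comm (v s)]; exact hkey s)
  -- the operator identity
  have hident : A = P * A * P + ((A * Zu * Du + Du * (Zu * A * P)) + (A * W * Dv + Dv * (W * A * P))) := by
    have e1 : (A * Zu * Du + Du * (Zu * A * P)) + (A * W * Dv + Dv * (W * A * P)) =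
        A * (Zu * Du + W * Dv) + (Du * Zu + Dv * W) * A * P := by
      simp only [Matrix.mul_add, Matrix.add_mul, Matrix.mul_assoc]
      abel
    rw [e1, h1, h2]
    simp only [Matrix.mul_sub, Matrix.sub_mul, Matrix.mul_one, Matrix.one_mul]
    abel
  -- the Gram part
  have hPSD : (P * A * P).PosSemidef := posSemidef_sectorCompression hF h
  set e : ι ≃ Fin (Fintype.card ι) := Fintype.equivFin ι with hedef
  refine ⟨Fintype.card ι, 0, 1, 1, 0, 0, 0, (P * A * P).submatrix e.symm e.symm,
    (posSemidef_submatrix_equiv e.symm).mpr hPSD, fun i => Matrix.single ∅ (e.symm i) (1 : ℂ),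
    Fin.elim0, fun _ => A * Zu, fun _ => Zu * A * P, fun _ => A * W, fun _ => W * A * P,
    Fin.elim0, Fin.elim0, fun j => j.elim0, Fin.elim0, Fin.elim0, Fin.elim0, Fin.elim0,
    (((lo : ℚ) : ℝ) : ℝ), by simp, ?_⟩
  rw [gramForm_submatrix_single (P * A * P) ∅ e, sum_numberOp_up_sub_eq_diagonal a,
    sum_numberOp_down_sub_eq_diagonal b]
  simp only [Finset.univ_eq_empty, Finset.sum_empty, Fin.sum_univ_one, zero_add, add_zero]
  exact hident

/-- `LowerCertificate ↔ LowerRow` for symmetric models on the physical range: the lower claim nodes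
of `Certificates/` are exactly as strong as the rows they carry (companion of
`upperCertificate_iff_upperRow`). -/
theorem lowerCertificate_iff_lowerRow {F : Model k} (hF : F.IsSymmetric) {a b : ℕ} (ha : a ≤ k)
    (hb : b ≤ k) (lo : ℚ) : LowerCertificate F a b lo ↔ LowerRow F a b lo :=
  ⟨lowerRow_of_certificate hF ha hb, lowerCertificate_of_lowerRow hF⟩

/-- Both certificate predicates together are exactly the bracket (physical range from `ha`, `hb`). -/
theorem certificates_iff_bracket {F : Model k} (hF : F.IsSymmetric) {a b : ℕ} (ha : a ≤ k)
    (hb : b ≤ k) (lo hi : ℚ) :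
    (LowerCertificate F a b lo ∧ UpperCertificate F a b hi) ↔ Bracket F a b lo hi :=
  and_congr (lowerCertificate_iff_lowerRow hF ha hb lo) (upperCertificate_iff_upperRow hF a b hi)

end Summit.Ventures.CertifiedQuantumChemistry

end
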